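import Summits.KontsevichZagierPeriods.KontsevichZagierPeriods.Theses.FurushoPentagon
import Summits.KontsevichZagierPeriods.KontsevichZagierPeriods.Theorems.FurushoPentagonSectorToKernelOfLeaves

/-!
# `SectorToKernel`, line `effective-cube-surjection`: Ayoub's conjecture decides the kernel on the resolved part

Crux `FurushoPentagon.SectorToKernel` (stmt-KontsevichZagierPeriods-10813). The landed composition
`kzKernel_of_cubeResolution_of_ayoubKernel` (`…SectorToKernelOfLeaves.lean`) takes the resolution stub S1
GLOBALLY (for all representations). Its proof uses S1 only on the combination at hand, so the same argument
gives the POINTWISE form, which is what the graded resolution programme (dimension `≤ 1` landed: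
`cubeResolution_dimLEOne`; bounded volumes; …) consumes:

* `kzKernel_of_ayoubKernel_of_resolved` (registered): granted Ayoub's effective cube conjecture (S6,
  written out), every formal combination `c` which is RESOLVED — congruent modulo the KZ relations to a
  `ℤ`-combination of tame cube classes — and evaluates to `0` is a relation;
* `resolved_of_mem_closure`: resolvedness passes from a set of generators to the subgroup it generates;
* `kzKernel_on_closure_of_ayoubKernel`: hence S6 decides Conjecture 1 (kernel form) on the subgroup
  generated by any family of resolved representations.

[Ayoub 2015, Conj. 1.1; Ayoub 2014, Rem. 12–13; Kontsevich–Zagier 2001, §1.2]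
-/

noncomputable section

namespace Summit.KontsevichZagierPeriods.FurushoPentagon.SectorToKernel

open Set MeasureTheory
open Literature.NumberTheory.Transcendental
open Literature.NumberTheory.Transcendental.KZ hiding cubicalSpan
open Summit.KontsevichZagierPeriods.KontsevichZagierPeriods.Theses.FurushoPentagon
open Summit.KontsevichZagierPeriods.FurushoPentagon.ReducedPeriodRing (unitCube cubicalGens cubicalSpan
  stub_cubeMerge)

/-- **Ayoub's effective cube conjecture decides the kernel on resolved combinations** (registered stub of
line `effective-cube-surjection`): if `c` is congruent modulo the KZ relations to a `ℤ`-combination of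
tame cube classes and `eval c = 0`, then — granted Ayoub 2015 Conj. 1.1 at `k = ℚ` — `c ∈ KZ.relations`.
Proof = steps (2)–(7) of `kzKernel_of_cubeResolution_of_ayoubKernel`: merge to one tame class
(`ReducedPeriodRing.stub_cubeMerge`), make it Ayoub-admissible (S2), read `∫ = 0` by soundness, take the
real Stokes form from the conjecture (S3), semialgebraicity of the primitives (S4), calibrate the padded
class (S5). [Ayoub 2015, Conj. 1.1; Ayoub 2014, Rem. 12–13; Kontsevich–Zagier 2001, §1.2] -/
theorem kzKernel_of_ayoubKernel_of_resolved :
    (∀ F ∈ AyoubRel.Oan (Rat.castHom ℂ), AyoubRel.intC F = 0 → F ∈ AyoubRel.kSpan (Rat.castHom ℂ) {x : AyoubRel.CSeries | ∃ G ∈ AyoubRel.Oan (Rat.castHom ℂ), ∃ i : ℕ, x = AyoubRel.relAC i G}) → ∀ c : FormalRep, (∃ a : FormalRep, a ∈ cubicalSpan ∧ c - a ∈ relations) → eval c = 0 → c ∈ relations := by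
  intro h6 c hres hc
  obtain ⟨a, ha, hca⟩ := hres
  -- merging: `a ∼ [r]`, `r` a tame cube class
  obtain ⟨n, r, hrd, hra, har⟩ := stub_cubeMerge a ha
  rw [leaves_unitCube_eq_cube] at hrd hra
  -- `[r] ∼ [s]`, `s` Ayoub-admissible
  obtain ⟨s, hsd, hadm, hrs⟩ := stub_admissibleOfTame n r hrd hra
  have hcs : c - of s ∈ relations := by
    have := relations.add_mem (relations.add_mem hca har) hrs
    simpa using this
  -- `∫_{[0,1]ⁿ} s = eval c = 0`
  have hs0 : ∫ x in KZ.cube n, s.integrand x = 0 := by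
    have h1 : eval (c - of s) = 0 := relations_le_ker_eval_holds hcs
    rw [map_sub, hc, zero_sub, neg_eq_zero, leaves_eval_of_eq_setIntegral_cube s hsd] at h1
    exact h1
  -- real Stokes form of the padded integrand, from the conjecture
  obtain ⟨d, k, i, H, hH, hid⟩ := stub_realStokesForm h6 n s hsd hadm hs0
  have hHs : ∀ j, AnalyticOnNhd ℝ (H j) (KZ.cube (n + d)) ∧
      IsSemialgebraicFunOn ℚ (KZ.cube (n + d)) (H j) :=
    fun j => ⟨(hH j).1, stub_semialgebraicOfAlgebraic (n + d) (H j) (hH j).1 (hH j).2⟩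
  -- pad `s` by `d` dummy variables and calibrate
  obtain ⟨u, hud, hui⟩ := leaves_exists_oneCube d
  have htd : (s.prod u).domain = KZ.cube (n + d) := by
    rw [IntegralRep.prod_domain, leaves_prodDomain_eq_cube s u hsd hud]
  have hti : ∀ z ∈ KZ.cube (n + d), (s.prod u).integrand z =
      ∑ j, (fderiv ℝ (H j) z (Pi.single (i j) 1) - H j (Function.update z (i j) 1) +
        H j (Function.update z (i j) 0)) := by
    intro z hz
    rw [leaves_prod_oneCube_integrand s u hui z]
    exact hid z hz
  have ht : of (s.prod u) ∈ relations :=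
    stub_stokesSpanCalibration (n + d) (s.prod u) htd k i H hHs hti
  have hst : of s - of (s.prod u) ∈ relations := leaves_of_sub_of_prod_oneCube s u hud hui
  have : c = (c - of s) + (of s - of (s.prod u)) + of (s.prod u) := by abel
  rw [this]
  exact relations.add_mem (relations.add_mem hcs hst) ht

/-- **Resolvedness is inherited by generated subgroups**: if every member of `S` is congruent modulo the
KZ relations to an element of `cubicalSpan`, so is every element of the subgroup generated by `S`.
[folklore] -/
theorem resolved_of_mem_closure (S : Set FormalRep)
    (hS : ∀ d ∈ S, ∃ a : FormalRep, a ∈ cubicalSpan ∧ d - a ∈ relations) :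
    ∀ c ∈ AddSubgroup.closure S, ∃ a : FormalRep, a ∈ cubicalSpan ∧ c - a ∈ relations := by
  intro c hc
  induction hc using AddSubgroup.closure_induction with
  | mem x hx => exact hS x hx
  | zero => exact ⟨0, cubicalSpan.zero_mem, by simp⟩
  | add x y _ _ hx hy =>
    obtain ⟨a, ha, hxa⟩ := hx
    obtain ⟨b, hb, hyb⟩ := hy
    refine ⟨a + b, cubicalSpan.add_mem ha hb, ?_⟩
    have : x + y - (a + b) = (x - a) + (y - b) := by abel
    rw [this]
    exact relations.add_mem hxa hyb
  | neg x _ hx =>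
    obtain ⟨a, ha, hxa⟩ := hx
    refine ⟨-a, cubicalSpan.neg_mem ha, ?_⟩
    have : -x - -a = -(x - a) := by abel
    rw [this]
    exact relations.neg_mem hxa

/-- **S6 decides the kernel form on every subgroup generated by resolved representations.** For a family
`S` of formal combinations each congruent to an element of `cubicalSpan` (e.g. the classes of all
representations of dimension `≤ 1`, `cubeResolution_dimLEOne`), Ayoub's effective cube conjecture implies
Conjecture 1 in kernel form on `AddSubgroup.closure S`. [Ayoub 2015, Conj. 1.1; Kontsevich–Zagier 2001, §1.2] -/
theorem kzKernel_on_closure_of_ayoubKernel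
    (h6 : ∀ F ∈ AyoubRel.Oan (Rat.castHom ℂ), AyoubRel.intC F = 0 →
      F ∈ AyoubRel.kSpan (Rat.castHom ℂ)
        {x : AyoubRel.CSeries | ∃ G ∈ AyoubRel.Oan (Rat.castHom ℂ), ∃ i : ℕ, x = AyoubRel.relAC i G})
    (S : Set FormalRep) (hS : ∀ d ∈ S, ∃ a : FormalRep, a ∈ cubicalSpan ∧ d - a ∈ relations) :
    ∀ c ∈ AddSubgroup.closure S, eval c = 0 → c ∈ relations :=
  fun c hc h0 => kzKernel_of_ayoubKernel_of_resolved h6 c (resolved_of_mem_closure S hS c hc) h0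

end Summit.KontsevichZagierPeriods.FurushoPentagon.SectorToKernel
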